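import Literature.AlgebraicGeometry.Resolution.AffineModelLU
import Mathlib.RingTheory.Valuation.ValuationSubring
import Mathlib.RingTheory.RegularLocalRing.Defs
import Mathlib.RingTheory.Localization.AtPrime.Basic

/-!
# `Valuative.TorsorToLurelFfinite`: transport of "regular at the centre" along field embeddings

Route `ResolutionOfSingularities/Valuative`, support item `TorsorToLurelFfinite`
(stmt-ResolutionOfSingularities-0643). Helper file (commutative algebra only).

If `ι : K₁ →+* K₂` is a homomorphism of fields, `O` a valuation ring of `K₂` and `B ⊆ K₁` a
subring contained in the pulled-back valuation ring `O.comap ι`, then `ι` restricts to a ring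
isomorphism `B ≃ ι(B)` carrying the centre `𝔪_{O.comap ι} ∩ B` onto the centre `𝔪_O ∩ ι(B)`, so
the two localisations at the centres are isomorphic and one is a regular local ring iff the other
is (`isRegularLocalRing_centre_map_iff`). This is used three times in the proof of
`TorsorToLurelFfinite`: along the inclusion of a subfield `E ⊆ K` (both directions) and along the
Frobenius `L → K, x ↦ x^{pⁿ}` of a purely inseparable extension `L/K`.
-/

noncomputable section

set_option linter.dupNamespace false -- mandated namespace of this single-conjunct summit

open IsLocalRing
open Literature.AlgebraicGeometry.Resolution

namespace Summit.ResolutionOfSingularities.ResolutionOfSingularities.Theorems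

universe u

/-- **Transport of regularity at the centre along a field embedding.** Let `ι : K₁ →+* K₂` be a
homomorphism of fields, `O` a valuation ring of `K₂`, `B ⊆ O.comap ι` a subring of `K₁` and
`B₂ = ι(B) ⊆ O`. Then `B` localised at the centre `𝔪_{O.comap ι} ∩ B` is a regular local ring iff
`B₂` localised at the centre `𝔪_O ∩ B₂` is. -/
theorem isRegularLocalRing_centre_map_iff {K₁ K₂ : Type u} [Field K₁] [Field K₂]
    (ι : K₁ →+* K₂) (O : ValuationSubring K₂) (B : Subring K₁) (B₂ : Subring K₂)
    (hB : B.map ι = B₂) (h₁ : B ≤ (O.comap ι).toSubring) (h₂ : B₂ ≤ O.toSubring) :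
    IsRegularLocalRing (Localization.AtPrime
        (Ideal.comap (Subring.inclusion h₁) (maximalIdeal ↥(O.comap ι)))) ↔
      IsRegularLocalRing (Localization.AtPrime
        (Ideal.comap (Subring.inclusion h₂) (maximalIdeal ↥O))) := by
  classical
  -- the ring isomorphism `B ≃ B₂` induced by `ι`
  let g : B ≃+* B₂ :=
    (B.equivMapOfInjective ι ι.injective).trans (RingEquiv.subringCongr hB)
  have hg : ∀ x : B, ((g x : B₂) : K₂) = ι x := fun _ => rfl
  set P₁ : Ideal B := Ideal.comap (Subring.inclusion h₁) (maximalIdeal ↥(O.comap ι)) with hP₁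
  set P₂ : Ideal B₂ := Ideal.comap (Subring.inclusion h₂) (maximalIdeal ↥O) with hP₂
  have hPP : P₁ = P₂.comap g.toRingHom := by
    ext x
    simp only [hP₁, hP₂, Ideal.mem_comap, RingEquiv.toRingHom_eq_coe, RingHom.coe_coe]
    rw [ValuationSubring.valuation_lt_one_iff, ValuationSubring.valuation_lt_one_iff]
    change (O.comap ι).valuation (x : K₁) < 1 ↔ O.valuation ((g x : B₂) : K₂) < 1
    rw [hg, valuation_comap_lt_one_iff]
  have hmap : Submonoid.map g.toRingHom.toMonoidHom P₁.primeCompl = P₂.primeCompl := by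
    ext y
    constructor
    · rintro ⟨x, hx, rfl⟩
      simpa [Ideal.primeCompl, hPP] using hx
    · intro hy
      refine ⟨g.symm y, ?_, by simp⟩
      simpa [Ideal.primeCompl, hPP] using hy
  let e : Localization.AtPrime P₁ ≃+* Localization.AtPrime P₂ :=
    IsLocalization.ringEquivOfRingEquiv (Localization.AtPrime P₁) (Localization.AtPrime P₂)
      g hmap
  exact ⟨fun h => IsRegularLocalRing.of_ringEquiv e, fun h => IsRegularLocalRing.of_ringEquiv e.symm⟩

end Summit.ResolutionOfSingularities.ResolutionOfSingularities.Theorems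

end
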